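import Literature.Analysis.FluidPDE.CaloricRemainderEnergyTested
import Literature.Analysis.FluidPDE.NSWeakStrongUniqueness
import HarnessLib

/-!
# The energy inequality of the caloric remainder on a time window `[a, b]`

Analysis/FluidPDE proof file (theorems only) on the Calderón / Rusin–Šverák route to the far-field
regularity of Kato's mild `L³` solution near the blow-up time
(`Literature.Analysis.FluidPDE.IsKatoSolutionOn.farField_bound`; W. Rusin, V. Šverák, J. Funct.
Anal. 260 (2011) = arXiv:0911.0500, §4 p. 6; C. P. Calderón, Trans. AMS 318 (1990), §1;
P. G. Lemarié-Rieusset, *The Navier–Stokes problem in the 21st century* (2016), Prop. 15.1 and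
proof of Thm. 14.7, pp. 516–518, and proof of Thm. 14.2, p. 499: "apply the local energy
inequality to the test function `φ(s, x) = γ(s) φ(x)`" with `γ` a smooth plateau, and let the
width of its ramps tend to zero).

From `caloric_remainder_tested_inequality` (the local energy inequality of the remainder
`w = u - e^{νtΔ}u₀` tested with `η(t) χ_R(x)`), choosing for `η` the plateau `timePlateau δ L (· - c)`
equal to one on `[a, b]` with ramps of width `δ` and letting `δ → 0` (the ramps are
approximate identities, `tendsto_integral_kernel_mul_of_continuousAt`, and
`t ↦ y_R(t) = ∫ |w(t)|² χ_R` is continuous since `u, e ∈ C([0, S); L³)`), we obtain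
(`caloric_remainder_window_inequality`), for `0 < a < b < S` and `R > 0`,

  `y_R(b) + ν ∫_a^b g_R ≤ y_R(a) + ∫_a^b (α(t) y_R(t) + β₀) dt + Err / R`,

`g_R(t) = ∫ |G(t) - De(t)|² χ_R`, `α(t) = 2 · 2^{3/2} M (νt)^{-1/2}`, `β₀ = M ‖u₀‖₃³ / ν`, with the
constant `Err` of `caloric_remainder_tested_inequality` (independent of `a`, `b`, `R`).

## Mathlib / tree search

Tree: `caloric_remainder_tested_inequality` (`CaloricRemainderEnergyTested.lean`); `timePlateau`,
`timePlateau_nonneg`, `timePlateau_le_one`, `contDiff_timePlateau`, `timePlateau_eq_one`,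
`tsupport_timePlateau_subset` (`KatoLocalLerayPressure.lean`);
`deriv_timePlateau_eq_rise_sub_fall`, `integral_plateauRise`, `integral_plateauFall`,
`plateauRise_eq_zero_of_notMem`, `plateauFall_eq_zero_of_notMem`,
`tendsto_integral_kernel_mul_of_continuousAt` (`PlateauWindowKernels.lean`);
`ContinuousInLpOn.sub`, `ContinuousInLpOn.smul_memLp_six`,
`ContinuousInLpOn.continuousOn_integral_norm_sq` (`KatoCaloricField.lean`);
`continuousInLpOn_heatFlow` (`HeatFlowLpClass.lean`); `frobeniusNormSq_sub_le`
(`NSWeakStrongUniqueness.lean`); `integrable_of_bound_on_compact`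
(`CaloricRemainderLocalEnergy.lean`). Mathlib: `deriv_comp_sub_const`,
`integral_sub_right_eq_self`, `tendsto_integral_of_dominated_convergence`.

## References

* W. Rusin, V. Šverák, J. Funct. Anal. 260 (2011) 879–891 = arXiv:0911.0500, §4 p. 6.
  [RusinSverak2011]
* P. G. Lemarié-Rieusset, *The Navier–Stokes problem in the 21st century*, CRC Press 2016,
  Prop. 15.1; Thm. 14.7, proof pp. 516–518; Thm. 14.2, proof p. 499. [LemarieRieusset2016]
-/

noncomputable section

open MeasureTheory TopologicalSpace Set Function Filter Topology Metric Real InnerProductSpace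

open scoped ENNReal NNReal RealInnerProductSpace Laplacian

namespace Literature.Analysis.FluidPDE

/-! ### Tools -/

section Tools

variable {S ν M : ℝ} {u₀ : (EuclideanSpace ℝ (Fin 3)) → (EuclideanSpace ℝ (Fin 3))}
  {u : ℝ → (EuclideanSpace ℝ (Fin 3)) → (EuclideanSpace ℝ (Fin 3))}
  {G : ℝ → (EuclideanSpace ℝ (Fin 3)) → (EuclideanSpace ℝ (Fin 3)) →L[ℝ] (EuclideanSpace ℝ (Fin 3))}

/-- On a box `[a', b'] × B̄(0, ρ)` with `0 < a'`, `b' < S`, the density `|G - De|²` of the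
remainder is integrable: `|G - De|² ≤ 2|G|² + 2|De|²`, `G ∈ L²` on compact subsets of the slab
and `De = ∇e^{νtΔ}u₀` is bounded for `t ≥ a'` (`‖De(t)‖ ≤ 2^{3/2}(νt)^{-1/2} M`). [folklore] -/
theorem integrableOn_frobeniusNormSq_sub_fderiv_heatFlow_box (hν : 0 < ν) (hM0 : 0 ≤ M)
    (hMb : ∀ x, ‖u₀ x‖ ≤ M) (hu₀ : MemLp u₀ 3 volume)
    (hG : HasWeakSpatialGradientOn (slab (EuclideanSpace ℝ (Fin 3)) (Ioo 0 S) isOpen_Ioo) u G)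
    (hG2 : ∀ K ⊆ ((slab (EuclideanSpace ℝ (Fin 3)) (Ioo 0 S) isOpen_Ioo :
        Opens (ℝ × (EuclideanSpace ℝ (Fin 3)))) : Set (ℝ × (EuclideanSpace ℝ (Fin 3)))),
      IsCompact K → ∫⁻ z in K, ENNReal.ofReal (frobeniusNormSq (G z.1 z.2)) < ∞)
    {a' b' ρ : ℝ} (ha' : 0 < a') (hb' : b' < S) :
    IntegrableOn (fun z : ℝ × (EuclideanSpace ℝ (Fin 3)) =>
        frobeniusNormSq (G z.1 z.2 - fderiv ℝ (heatFlow u₀ (ν * z.1)) z.2))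
      (Icc a' b' ×ˢ closedBall (0 : EuclideanSpace ℝ (Fin 3)) ρ) volume ∧
    AEStronglyMeasurable (fun z : ℝ × (EuclideanSpace ℝ (Fin 3)) =>
        frobeniusNormSq (G z.1 z.2 - fderiv ℝ (heatFlow u₀ (ν * z.1)) z.2))
      (volume.restrict (Ioo 0 S ×ˢ (univ : Set (EuclideanSpace ℝ (Fin 3))))) := by
  set K : Set (ℝ × (EuclideanSpace ℝ (Fin 3))) := Icc a' b' ×ˢ closedBall (0 : EuclideanSpace ℝ (Fin 3)) ρ
    with hK
  have hKc : IsCompact K := isCompact_Icc.prod (isCompact_closedBall _ _)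
  have hKΩ : K ⊆ ((slab (EuclideanSpace ℝ (Fin 3)) (Ioo 0 S) isOpen_Ioo :
      Opens (ℝ × (EuclideanSpace ℝ (Fin 3)))) : Set (ℝ × (EuclideanSpace ℝ (Fin 3)))) :=
    fun z hz => ⟨⟨ha'.trans_le hz.1.1, hz.1.2.trans_lt hb'⟩, mem_univ _⟩
  have hstrip : Ioo 0 S ×ˢ (univ : Set (EuclideanSpace ℝ (Fin 3))) ⊆
      ((slab (EuclideanSpace ℝ (Fin 3)) (Ioo 0 S) isOpen_Ioo :
        Opens (ℝ × (EuclideanSpace ℝ (Fin 3)))) : Set (ℝ × (EuclideanSpace ℝ (Fin 3)))) :=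
    fun z hz => hz
  -- continuity of the Frobenius density
  set b := stdOrthonormalBasis ℝ (EuclideanSpace ℝ (Fin 3))
  have hfrob_c : Continuous fun L : (EuclideanSpace ℝ (Fin 3)) →L[ℝ] (EuclideanSpace ℝ (Fin 3)) =>
      frobeniusNormSq L := by
    have : (fun L : (EuclideanSpace ℝ (Fin 3)) →L[ℝ] (EuclideanSpace ℝ (Fin 3)) => frobeniusNormSq L) =
        fun L => ∑ i, ‖L (b i)‖ ^ 2 := funext fun L => frobeniusNormSq_eq_sum b L
    rw [this]
    exact continuous_finsetSum _ fun i _ => ((ContinuousLinearMap.apply ℝ _ (b i)).continuous.norm).pow 2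
  -- measurability of `G` and continuity of `De` on `t > 0`
  have hGm : AEStronglyMeasurable (fun z : ℝ × (EuclideanSpace ℝ (Fin 3)) => G z.1 z.2)
      (volume.restrict (Ioo 0 S ×ˢ (univ : Set (EuclideanSpace ℝ (Fin 3))))) :=
    (hG.locallyIntegrableOn_grad.aestronglyMeasurable).mono_measure (Measure.restrict_mono hstrip le_rfl)
  have hsm : IsSmoothSpaceTimeOn (Ioi 0) fun t x => heatFlow u₀ (ν * t) x :=
    contDiffOn_uncurry_heatFlow hu₀ (by norm_num) hν
  have hDc : ContinuousOn (uncurry fun t x => fderiv ℝ (heatFlow u₀ (ν * t)) x)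
      (Ioi 0 ×ˢ (univ : Set (EuclideanSpace ℝ (Fin 3)))) :=
    (hsm.fderiv_slice isOpen_Ioi.uniqueDiffOn).continuousOn
  have hDm : AEStronglyMeasurable (fun z : ℝ × (EuclideanSpace ℝ (Fin 3)) => fderiv ℝ (heatFlow u₀ (ν * z.1)) z.2)
      (volume.restrict (Ioo 0 S ×ˢ (univ : Set (EuclideanSpace ℝ (Fin 3))))) :=
    (hDc.mono (prod_mono Ioo_subset_Ioi_self Subset.rfl)).aestronglyMeasurable
      (measurableSet_Ioo.prod MeasurableSet.univ)
  have hFm : AEStronglyMeasurable (fun z : ℝ × (EuclideanSpace ℝ (Fin 3)) =>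
      frobeniusNormSq (G z.1 z.2 - fderiv ℝ (heatFlow u₀ (ν * z.1)) z.2))
      (volume.restrict (Ioo 0 S ×ˢ (univ : Set (EuclideanSpace ℝ (Fin 3))))) :=
    hfrob_c.comp_aestronglyMeasurable (hGm.sub hDm)
  refine ⟨?_, hFm⟩
  -- `|G|²` is integrable on `K`
  have hKstrip : K ⊆ Ioo 0 S ×ˢ (univ : Set (EuclideanSpace ℝ (Fin 3))) := hKΩ
  have gG2 : IntegrableOn (fun z : ℝ × (EuclideanSpace ℝ (Fin 3)) => frobeniusNormSq (G z.1 z.2)) K volume := by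
    refine ⟨hfrob_c.comp_aestronglyMeasurable (hGm.mono_measure (Measure.restrict_mono hKstrip le_rfl)), ?_⟩
    refine lt_of_le_of_lt (lintegral_mono fun z => ?_) (hG2 K hKΩ hKc)
    rw [Real.enorm_eq_ofReal (frobeniusNormSq_nonneg _)]
  -- `|De|²` is bounded on `K`
  set D₁ : ℝ := 2 ^ ((3 : ℝ) / 2) * (ν * a') ^ (-(1 / 2 : ℝ)) * M with hD₁
  have hDe : ∀ z ∈ K, ‖fderiv ℝ (heatFlow u₀ (ν * z.1)) z.2‖ ≤ D₁ := by
    intro z hz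
    have ht : 0 < z.1 := ha'.trans_le hz.1.1
    have h := norm_fderiv_heatFlow_le_of_bound hu₀.aestronglyMeasurable hMb (mul_pos hν ht) z.2
    rw [finrank_euclideanSpace_fin] at h
    refine h.trans ?_
    have hr : (ν * z.1) ^ (-(1 / 2 : ℝ)) ≤ (ν * a') ^ (-(1 / 2 : ℝ)) :=
      Real.rpow_le_rpow_of_nonpos (mul_pos hν ha') (mul_le_mul_of_nonneg_left hz.1.1 hν.le) (by norm_num)
    rw [hD₁]
    push_cast
    exact mul_le_mul_of_nonneg_right (mul_le_mul_of_nonneg_left hr (by positivity)) hM0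
  have hDe2 : ∀ z ∈ K, frobeniusNormSq (fderiv ℝ (heatFlow u₀ (ν * z.1)) z.2) ≤ 3 * D₁ ^ 2 := by
    intro z hz
    have h := frobeniusNormSq_le_finrank_mul_sq_norm (fderiv ℝ (heatFlow u₀ (ν * z.1)) z.2)
    rw [finrank_euclideanSpace_fin] at h
    push_cast at h
    refine h.trans ?_
    exact mul_le_mul_of_nonneg_left (pow_le_pow_left₀ (norm_nonneg _) (hDe z hz) 2) (by norm_num)
  have h1 : IntegrableOn (fun z : ℝ × (EuclideanSpace ℝ (Fin 3)) =>
      2 * frobeniusNormSq (G z.1 z.2) + 2 * (3 * D₁ ^ 2)) K volume :=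
    (gG2.const_mul 2).add (integrableOn_const (hs := hKc.measure_lt_top.ne)).integrable
  refine Integrable.mono' h1 (hFm.mono_measure (Measure.restrict_mono hKstrip le_rfl))
    ((ae_restrict_iff' (measurableSet_Icc.prod measurableSet_closedBall)).2 (Eventually.of_forall fun z hz => ?_))
  rw [Real.norm_eq_abs, abs_of_nonneg (frobeniusNormSq_nonneg _)]
  refine (frobeniusNormSq_sub_le _ _).trans ?_
  linarith [hDe2 z hz, frobeniusNormSq_nonneg (G z.1 z.2)]

/-- Continuity of the cut-off energy of the remainder, `t ↦ ∫ |u(t) - e^{νtΔ}u₀|² χ_R`, on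
`[0, S)` for `u ∈ C([0, S); L³)` and `u₀ ∈ L³` (Hölder with the bounded compactly supported
weight `√χ_R ∈ L⁶`). [folklore] -/
theorem continuousOn_integral_norm_sq_sub_heatFlow_mul_cutoff (hν : 0 < ν) (hu₀ : MemLp u₀ 3 volume)
    (hcont : ContinuousInLpOn (Ico 0 S) 3 u) {R : ℝ} (hR : 0 < R) :
    ContinuousOn (fun t => ∫ x, ‖u t x - heatFlow u₀ (ν * t) x‖ ^ 2 * cutoff R x) (Ico 0 S) := by
  have he : ContinuousInLpOn (Ico 0 S) 3 fun t => heatFlow u₀ (ν * t) :=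
    (continuousInLpOn_heatFlow hu₀ (by norm_num) (by norm_num) hν.le).mono Ico_subset_Ici_self
  have hw : ContinuousInLpOn (Ico 0 S) 3 fun t x => u t x - heatFlow u₀ (ν * t) x := hcont.sub (by norm_num) he
  set θ : (EuclideanSpace ℝ (Fin 3)) → ℝ := fun x => Real.sqrt (cutoff R x) with hθ
  have hθc : Continuous θ := Real.continuous_sqrt.comp (contDiff_cutoff (E := EuclideanSpace ℝ (Fin 3)) (n := 0) R).continuous
  have hθs : HasCompactSupport θ := (hasCompactSupport_cutoff hR).comp_left Real.sqrt_zero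
  have hθ6 : MemLp θ 6 (volume : Measure (EuclideanSpace ℝ (Fin 3))) := hθc.memLp_of_hasCompactSupport hθs
  have h := (hw.smul_memLp_six hθ6).continuousOn_integral_norm_sq
  refine h.congr fun t _ => integral_congr_ae (ae_of_all _ fun x => ?_)
  show ‖u t x - heatFlow u₀ (ν * t) x‖ ^ 2 * cutoff R x = ‖θ x • (u t x - heatFlow u₀ (ν * t) x)‖ ^ 2
  rw [norm_smul, mul_pow, Real.norm_eq_abs, sq_abs, hθ, Real.sq_sqrt (cutoff_nonneg R x), mul_comm]

end Tools

/-! ### The window inequality -/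

section Window

variable {S ν M : ℝ} {u₀ : (EuclideanSpace ℝ (Fin 3)) → (EuclideanSpace ℝ (Fin 3))}
  {u : ℝ → (EuclideanSpace ℝ (Fin 3)) → (EuclideanSpace ℝ (Fin 3))} {p : ℝ → (EuclideanSpace ℝ (Fin 3)) → ℝ}
  {G : ℝ → (EuclideanSpace ℝ (Fin 3)) → (EuclideanSpace ℝ (Fin 3)) →L[ℝ] (EuclideanSpace ℝ (Fin 3))}

/-- **The energy inequality of the caloric remainder on a time window** (Rusin–Šverák 2011, §4
p. 6: "the equation for `v`, together with the local energy inequality, implies that `v` is in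
the energy class up to the blow-up time"; Lemarié-Rieusset 2016, Prop. 15.1 / proof of
Thm. 14.7 pp. 516–518, with the plateau test in time of the proof of Thm. 14.2, p. 499). In the
setting of `caloric_remainder_tested_inequality` (a distributional solution `(u, p)` on the slab
`(0, S) × ℝ³` with weak gradient `G` and the local energy inequality, `u ∈ L³`, `p ∈ L^{3/2}` on
the strip, `u ∈ C([0, S); L³)`, bounded weakly divergence-free `u₀ ∈ L³`, `|u₀| ≤ M`,
`e(t) = e^{νtΔ}u₀`, `w = u - e`), there is `Err ≥ 0` such that for all `0 < a < b < S` and `R > 0`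

  `y_R(b) + ν ∫_{[a,b]} g_R ≤ y_R(a) + ∫_{[a,b]} (α y_R + β₀) + Err / R`,

where `y_R(t) = ∫ |w(t)|² χ_R`, `g_R(t) = ∫ |G(t) - De(t)|² χ_R`, `α(t) = 2 · 2^{3/2} M (νt)^{-1/2}`
and `β₀ = M ‖u₀‖₃³ / ν`. [cite: RusinSverak2011, §4 p. 6] -/
theorem caloric_remainder_window_inequality (hν : 0 < ν) (hS : 0 < S) (hM0 : 0 ≤ M)
    (hMb : ∀ x, ‖u₀ x‖ ≤ M) (hu₀ : MemLp u₀ 3 volume) (hdiv₀ : IsWeaklyDivFree u₀)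
    (hNS : IsDistributionalNSSolutionOn (slab (EuclideanSpace ℝ (Fin 3)) (Ioo 0 S) isOpen_Ioo) ν 0 u p)
    (hG : HasWeakSpatialGradientOn (slab (EuclideanSpace ℝ (Fin 3)) (Ioo 0 S) isOpen_Ioo) u G)
    (hG2 : ∀ K ⊆ ((slab (EuclideanSpace ℝ (Fin 3)) (Ioo 0 S) isOpen_Ioo : Opens (ℝ × (EuclideanSpace ℝ (Fin 3)))) : Set (ℝ × (EuclideanSpace ℝ (Fin 3)))), IsCompact K →
      ∫⁻ z in K, ENNReal.ofReal (frobeniusNormSq (G z.1 z.2)) < ∞)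
    (hLEI : ∀ φ : ℝ → (EuclideanSpace ℝ (Fin 3)) → ℝ, IsSpaceTimeTestOn (slab (EuclideanSpace ℝ (Fin 3)) (Ioo 0 S) isOpen_Ioo) φ → (∀ t x, 0 ≤ φ t x) →
      2 * ν * ∫ t, ∫ x, frobeniusNormSq (G t x) * φ t x ≤
        ∫ t, ∫ x, (‖u t x‖ ^ 2 * (timeDeriv φ t x + ν * Δ (φ t) x) +
          (‖u t x‖ ^ 2 + 2 * p t x) * ⟪u t x, gradient (φ t) x⟫ +
          2 * ⟪(0 : ℝ → (EuclideanSpace ℝ (Fin 3)) → (EuclideanSpace ℝ (Fin 3))) t x, u t x⟫ * φ t x))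
    (hu3 : MemLp (uncurry u) 3 (volume.restrict (Ioo 0 S ×ˢ univ)))
    (hp32 : MemLp (uncurry p) (3 / 2) (volume.restrict (Ioo 0 S ×ˢ univ)))
    (hcont : ContinuousInLpOn (Ico 0 S) 3 u) :
    ∃ Err : ℝ, 0 ≤ Err ∧ ∀ (a b : ℝ), 0 < a → a < b → b < S → ∀ R : ℝ, 0 < R →
      (∫ x, ‖u b x - heatFlow u₀ (ν * b) x‖ ^ 2 * cutoff R x) +
        ν * ∫ t in Icc a b, ∫ x, frobeniusNormSq (G t x - fderiv ℝ (heatFlow u₀ (ν * t)) x) * cutoff R x ≤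
      (∫ x, ‖u a x - heatFlow u₀ (ν * a) x‖ ^ 2 * cutoff R x) +
        (∫ t in Icc a b, ((2 * (2 ^ ((3 : ℝ) / 2) * (ν * t) ^ (-(1 / 2 : ℝ)) * M)) *
          (∫ x, ‖u t x - heatFlow u₀ (ν * t) x‖ ^ 2 * cutoff R x) + M * (∫ x, ‖u₀ x‖ ^ 3) / ν)) +
        Err / R := by
  obtain ⟨Err, hErr0, hB⟩ := caloric_remainder_tested_inequality hν hS hM0 hMb hu₀ hdiv₀ hNS hG hG2 hLEI
    hu3 hp32 hcont
  refine ⟨Err, hErr0, ?_⟩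
  intro a b ha hab hbS R hR
  -- ### notation
  set y : ℝ → ℝ := fun t => ∫ x, ‖u t x - heatFlow u₀ (ν * t) x‖ ^ 2 * cutoff R x with hy
  set g : ℝ → ℝ := fun t => ∫ x, frobeniusNormSq (G t x - fderiv ℝ (heatFlow u₀ (ν * t)) x) * cutoff R x
    with hg
  set α : ℝ → ℝ := fun t => 2 * (2 ^ ((3 : ℝ) / 2) * (ν * t) ^ (-(1 / 2 : ℝ)) * M) with hα
  set β₀ : ℝ := M * (∫ x, ‖u₀ x‖ ^ 3) / ν with hβ₀
  have hβ₀0 : 0 ≤ β₀ := by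
    rw [hβ₀]; exact div_nonneg (mul_nonneg hM0 (integral_nonneg fun _ => by positivity)) hν.le
  have hα0 : ∀ t, 0 < t → 0 ≤ α t := fun t ht => by
    rw [hα]; exact mul_nonneg two_pos.le (mul_nonneg (mul_nonneg (by positivity)
      (Real.rpow_nonneg (mul_nonneg hν.le ht.le) _)) hM0)
  have hαc : ContinuousOn α (Ioi 0) := by
    rw [hα]
    refine continuousOn_const.mul ((continuousOn_const.mul ?_).mul continuousOn_const)
    exact ContinuousOn.rpow_const (continuousOn_const.mul continuousOn_id)
      fun t ht => Or.inl (mul_pos hν ht).ne'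
  have hχ0 : ∀ x : (EuclideanSpace ℝ (Fin 3)), 0 ≤ cutoff R x := fun x => cutoff_nonneg R x
  have hχ1 : ∀ x : (EuclideanSpace ℝ (Fin 3)), cutoff R x ≤ 1 := fun x => cutoff_le_one R x
  have hχz : ∀ x : (EuclideanSpace ℝ (Fin 3)), x ∉ closedBall (0 : EuclideanSpace ℝ (Fin 3)) (2 * R) →
      cutoff R x = 0 := fun x hx => by
    rw [mem_closedBall_zero_iff, not_le] at hx
    exact cutoff_eq_zero hR hx.le
  have hχm : AEStronglyMeasurable (cutoff R) (volume : Measure (EuclideanSpace ℝ (Fin 3))) :=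
    (contDiff_cutoff (E := EuclideanSpace ℝ (Fin 3)) (n := 0) R).continuous.aestronglyMeasurable
  have hy0 : ∀ t, 0 ≤ y t := fun t => integral_nonneg fun x => mul_nonneg (sq_nonneg _) (hχ0 x)
  have hg0 : ∀ t, 0 ≤ g t := fun t => integral_nonneg fun x => mul_nonneg (frobeniusNormSq_nonneg _) (hχ0 x)
  -- the enlarged window `[a', b'] ⊂ (0, S)`
  set a' : ℝ := a / 2 with ha'
  set b' : ℝ := (b + S) / 2 with hb'
  have ha'0 : 0 < a' := by positivity
  have ha'a : a' < a := by rw [ha']; linarith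
  have hbb' : b < b' := by rw [hb']; linarith
  have hb'S : b' < S := by rw [hb']; linarith
  -- ### continuity of `y` and integrability of `g`, `α y` on `[a', b']`
  have hyc : ContinuousOn y (Ico 0 S) := continuousOn_integral_norm_sq_sub_heatFlow_mul_cutoff hν hu₀ hcont hR
  have ha'b' : a' < b' := by linarith
  have hIcc : Icc a' b' ⊆ Ico 0 S := fun t ht => ⟨ha'0.le.trans ht.1, ht.2.trans_lt hb'S⟩
  have hyc' : ContinuousOn y (Icc a' b') := hyc.mono hIcc
  -- `y` is bounded on `[a', b']`; its integrable extension `Y` by zero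
  set Y : ℝ → ℝ := indicator (Icc a' b') y with hY
  have hYi : Integrable Y := by
    rw [hY, integrable_indicator_iff measurableSet_Icc]
    exact hyc'.integrableOn_compact isCompact_Icc
  have hYy : ∀ t ∈ Icc a' b', Y t = y t := fun t ht => indicator_of_mem ht _
  have hYa : ContinuousAt Y a := by
    have h1 : ContinuousAt y a := hyc.continuousAt (Ico_mem_nhds ha (hab.trans hbS))
    refine h1.congr (eventuallyEq_of_mem (Icc_mem_nhds ha'a (hab.trans hbb')) fun t ht => (hYy t ht).symm)
  have hYb : ContinuousAt Y b := by
    have h1 : ContinuousAt y b := hyc.continuousAt (Ico_mem_nhds (ha.trans hab) hbS)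
    refine h1.congr (eventuallyEq_of_mem (Icc_mem_nhds (ha'a.trans hab) hbb') fun t ht => (hYy t ht).symm)
  -- `g` is integrable on `[a', b']`
  obtain ⟨hFK, hFm⟩ := integrableOn_frobeniusNormSq_sub_fderiv_heatFlow_box (ρ := 2 * R) hν hM0 hMb hu₀ hG hG2
    ha'0 hb'S
  set Kb : Set (ℝ × (EuclideanSpace ℝ (Fin 3))) := Icc a' b' ×ˢ closedBall (0 : (EuclideanSpace ℝ (Fin 3))) (2 * R) with hKb
  have hKbc : IsCompact Kb := isCompact_Icc.prod (isCompact_closedBall _ _)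
  have hKbstrip : Kb ⊆ Ioo 0 S ×ˢ (univ : Set (EuclideanSpace ℝ (Fin 3))) := fun z hz =>
    ⟨⟨ha'0.trans_le hz.1.1, hz.1.2.trans_lt hb'S⟩, mem_univ _⟩
  have hPi : Integrable (fun z : ℝ × (EuclideanSpace ℝ (Fin 3)) => indicator (Icc a' b') (fun _ => (1 : ℝ)) z.1 *
      (frobeniusNormSq (G z.1 z.2 - fderiv ℝ (heatFlow u₀ (ν * z.1)) z.2) * cutoff R z.2)) volume := by
    refine integrable_of_bound_on_compact hKbc hFK ?_ (fun z hz => ?_) (fun z hz => ?_)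
    · refine (((measurable_const.indicator measurableSet_Icc).comp measurable_fst).aestronglyMeasurable).mul
        ((hFm.mono_measure (Measure.restrict_mono hKbstrip le_rfl)).mul ?_)
      exact ((contDiff_cutoff (E := (EuclideanSpace ℝ (Fin 3))) (n := 0) R).continuous.comp continuous_snd).aestronglyMeasurable
    · rw [hKb, mem_prod, not_and_or] at hz
      rcases hz with h | h
      · rw [indicator_of_notMem h, zero_mul]
      · rw [hχz z.2 h, mul_zero, mul_zero]
    · rw [indicator_of_mem hz.1, one_mul, Real.norm_eq_abs,
        abs_of_nonneg (mul_nonneg (frobeniusNormSq_nonneg _) (hχ0 _))]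
      exact mul_le_of_le_one_right (frobeniusNormSq_nonneg _) (hχ1 _)
  have hgI : Integrable (indicator (Icc a' b') g) := by
    refine hPi.integral_prod_left.congr (ae_of_all _ fun t => ?_)
    show (∫ x, indicator (Icc a' b') (fun _ => (1 : ℝ)) t *
      (frobeniusNormSq (G t x - fderiv ℝ (heatFlow u₀ (ν * t)) x) * cutoff R x)) = indicator (Icc a' b') g t
    by_cases ht : t ∈ Icc a' b'
    · rw [indicator_of_mem ht, indicator_of_mem ht, hg]
      exact integral_congr_ae (ae_of_all _ fun x => by simp only [one_mul])
    · rw [indicator_of_notMem ht, indicator_of_notMem ht]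
      simp
  -- `α y` is integrable on `[a', b']`
  have hαyc : ContinuousOn (fun t => α t * y t) (Icc a' b') :=
    (hαc.mono fun t ht => ha'0.trans_le ht.1).mul hyc'
  have hαyI : Integrable (indicator (Icc a' b') fun t => α t * y t) :=
    (integrable_indicator_iff measurableSet_Icc).2 (hαyc.integrableOn_compact isCompact_Icc)
  -- ### the ramp widths `δ_k → 0` and the plateaux `η_k`
  set δ₀ : ℝ := min (min ((a - a') / 2) ((b' - b) / 2)) 1 with hδ₀
  have hδ₀pos : 0 < δ₀ := lt_min (lt_min (by linarith) (by linarith)) one_pos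
  have hδ₀a : δ₀ ≤ (a - a') / 2 := (min_le_left _ _).trans (min_le_left _ _)
  have hδ₀b : δ₀ ≤ (b' - b) / 2 := (min_le_left _ _).trans (min_le_right _ _)
  set δ : ℕ → ℝ := fun k => δ₀ / ((k : ℝ) + 2) with hδ
  have hδpos : ∀ k, 0 < δ k := fun k => by positivity
  have hδlt : ∀ k, δ k < δ₀ := fun k => by
    rw [hδ]; dsimp only
    rw [div_lt_iff₀ (by positivity)]
    nlinarith [(Nat.cast_nonneg k : (0 : ℝ) ≤ k)]
  have hδ1 : ∀ k, δ k ≤ 1 := fun k => (hδlt k).le.trans (min_le_right _ _)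
  have hδa : ∀ k, a' < a - 2 * δ k := fun k => by linarith [hδlt k]
  have hδb : ∀ k, b + 2 * δ k < b' := fun k => by linarith [hδlt k]
  have hδlim : Tendsto δ atTop (𝓝 0) :=
    tendsto_const_nhds.div_atTop (tendsto_natCast_atTop_atTop.atTop_add tendsto_const_nhds)
  set L : ℕ → ℝ := fun k => b - a + 4 * δ k with hL
  set c : ℕ → ℝ := fun k => a - 2 * δ k with hc
  set η : ℕ → ℝ → ℝ := fun k t => timePlateau (δ k) (L k) (t - c k) with hη
  have hηC : ∀ k, ContDiff ℝ (⊤ : ℕ∞) (η k) := fun k =>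
    (contDiff_timePlateau _ _).comp (contDiff_id.sub contDiff_const)
  have hη0 : ∀ k t, 0 ≤ η k t := fun k t => timePlateau_nonneg _ _ _
  have hη1 : ∀ k t, η k t ≤ 1 := fun k t => timePlateau_le_one _ _ _
  have hηsupp : ∀ k, support (η k) ⊆ Icc (a - δ k) (b + δ k) := by
    intro k t ht
    have h := tsupport_timePlateau_subset (S := L k) (hδpos k)
      (subset_tsupport _ (show t - c k ∈ support (timePlateau (δ k) (L k)) from ht))
    rw [mem_Icc] at h ⊢
    have hc' : c k = a - 2 * δ k := rfl
    have hL' : L k = b - a + 4 * δ k := rfl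
    constructor <;> linarith [h.1, h.2]
  have hηout : ∀ k t, t ∉ Icc (a - δ k) (b + δ k) → η k t = 0 := fun k t ht => by
    by_contra h; exact ht (hηsupp k h)
  have hηout' : ∀ k t, t ∉ Icc a' b' → η k t = 0 := fun k t ht =>
    hηout k t fun h => ht ⟨by linarith [h.1, hδa k, hδpos k], by linarith [h.2, hδb k, hδpos k]⟩
  have hηone : ∀ k, ∀ t ∈ Icc a b, η k t = 1 := fun k t ht => by
    have hc' : c k = a - 2 * δ k := rfl
    have hL' : L k = b - a + 4 * δ k := rfl
    exact timePlateau_eq_one (hδpos k) (by rw [hc']; linarith [ht.1]) (by rw [hc', hL']; linarith [ht.2])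
  have hηm : ∀ k, AEStronglyMeasurable (η k) volume := fun k => (hηC k).continuous.aestronglyMeasurable
  -- the ramps: approximate identities at `a` and at `b`
  set κ₁ : ℕ → ℝ → ℝ := fun k t => (1 / δ k) * deriv smoothTransition (((t - c k) - δ k) / δ k) with hκ₁
  set κ₂ : ℕ → ℝ → ℝ := fun k t => (1 / δ k) * deriv smoothTransition ((L k - δ k - (t - c k)) / δ k) with hκ₂
  have hηd : ∀ k t, deriv (η k) t = κ₁ k t - κ₂ k t := by
    intro k t
    show deriv (fun t => timePlateau (δ k) (L k) (t - c k)) t = _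
    rw [deriv_comp_sub_const, deriv_timePlateau_eq_rise_sub_fall (hδpos k) (by
      show 4 * δ k ≤ b - a + 4 * δ k; linarith)]
  have hκ₁c : ∀ k, Continuous (κ₁ k) := fun k =>
    (continuous_plateauRise (δ k)).comp (continuous_id.sub continuous_const)
  have hκ₂c : ∀ k, Continuous (κ₂ k) := fun k =>
    (continuous_plateauFall (δ k) (L k)).comp (continuous_id.sub continuous_const)
  have hκ₁0 : ∀ k t, 0 ≤ κ₁ k t := fun k t => plateauRise_nonneg (hδpos k) _
  have hκ₂0 : ∀ k t, 0 ≤ κ₂ k t := fun k t => plateauFall_nonneg (hδpos k) _ _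
  have hκ₁supp : ∀ k t, κ₁ k t ≠ 0 → t ∈ Icc (a - δ k) (a + δ k) := by
    intro k t ht
    by_contra hn
    refine ht (plateauRise_eq_zero_of_notMem (hδpos k) fun h => hn ?_)
    have hc' : c k = a - 2 * δ k := rfl
    rw [mem_Icc] at h ⊢
    constructor <;> linarith [h.1, h.2, hδpos k]
  have hκ₂supp : ∀ k t, κ₂ k t ≠ 0 → t ∈ Icc (b - δ k) (b + δ k) := by
    intro k t ht
    by_contra hn
    refine ht (plateauFall_eq_zero_of_notMem (hδpos k) fun h => hn ?_)
    have hc' : c k = a - 2 * δ k := rfl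
    have hL' : L k = b - a + 4 * δ k := rfl
    rw [mem_Icc] at h ⊢
    constructor <;> linarith [h.1, h.2, hδpos k]
  have hκ₁1 : ∀ k, ∫ t, κ₁ k t = 1 := fun k => by
    have h := integral_sub_right_eq_self (μ := (volume : Measure ℝ))
      (fun s => (1 / δ k) * deriv smoothTransition ((s - δ k) / δ k)) (c k)
    rw [integral_plateauRise (hδpos k)] at h
    exact h
  have hκ₂1 : ∀ k, ∫ t, κ₂ k t = 1 := fun k => by
    have h := integral_sub_right_eq_self (μ := (volume : Measure ℝ))
      (fun s => (1 / δ k) * deriv smoothTransition ((L k - δ k - s) / δ k)) (c k)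
    rw [integral_plateauFall (hδpos k)] at h
    exact h
  have hE1 : Tendsto (fun k => ∫ t, κ₁ k t * Y t) atTop (𝓝 (Y a)) :=
    tendsto_integral_kernel_mul_of_continuousAt hYa hYi.integrableOn hδ1 hδlim hκ₁c hκ₁0 hκ₁supp hκ₁1
  have hE2 : Tendsto (fun k => ∫ t, κ₂ k t * Y t) atTop (𝓝 (Y b)) :=
    tendsto_integral_kernel_mul_of_continuousAt hYb hYi.integrableOn hδ1 hδlim hκ₂c hκ₂0 hκ₂supp hκ₂1
  have hYa' : Y a = (∫ x, ‖u a x - heatFlow u₀ (ν * a) x‖ ^ 2 * cutoff R x) := hYy a ⟨ha'a.le, (hab.trans hbb').le⟩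
  have hYb' : Y b = (∫ x, ‖u b x - heatFlow u₀ (ν * b) x‖ ^ 2 * cutoff R x) := hYy b ⟨(ha'a.trans hab).le, hbb'.le⟩
  -- integrability of the ramp terms and the identity `∫ η' y = ∫ κ₁ Y - ∫ κ₂ Y`
  have hκYi : ∀ k, Integrable (fun t => κ₁ k t * Y t) ∧ Integrable (fun t => κ₂ k t * Y t) := by
    intro k
    have hs₁ : HasCompactSupport (κ₁ k) := HasCompactSupport.of_support_subset_isCompact isCompact_Icc
      (fun t ht => hκ₁supp k t ht)
    have hs₂ : HasCompactSupport (κ₂ k) := HasCompactSupport.of_support_subset_isCompact isCompact_Icc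
      (fun t ht => hκ₂supp k t ht)
    obtain ⟨C₁, hC₁⟩ := (hκ₁c k).bounded_above_of_compact_support hs₁
    obtain ⟨C₂, hC₂⟩ := (hκ₂c k).bounded_above_of_compact_support hs₂
    exact ⟨hYi.bdd_mul (hκ₁c k).aestronglyMeasurable (ae_of_all _ hC₁),
      hYi.bdd_mul (hκ₂c k).aestronglyMeasurable (ae_of_all _ hC₂)⟩
  have hE : ∀ k, (∫ t, deriv (η k) t * (∫ x, ‖u t x - heatFlow u₀ (ν * t) x‖ ^ 2 * cutoff R x)) = (∫ t, κ₁ k t * Y t) - ∫ t, κ₂ k t * Y t := by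
    intro k
    rw [← integral_sub (hκYi k).1 (hκYi k).2]
    refine integral_congr_ae (ae_of_all _ fun t => ?_)
    show deriv (η k) t * (∫ x, ‖u t x - heatFlow u₀ (ν * t) x‖ ^ 2 * cutoff R x) = κ₁ k t * Y t - κ₂ k t * Y t
    rw [hηd]
    by_cases ht : t ∈ Icc a' b'
    · rw [hYy t ht]; ring
    · have h1 : κ₁ k t = 0 := by
        by_contra h; exact ht (let h' := hκ₁supp k t h; ⟨by linarith [h'.1, hδa k, hδpos k], by linarith [h'.2, hδb k, hδpos k, hab]⟩)
      have h2 : κ₂ k t = 0 := by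
        by_contra h; exact ht (let h' := hκ₂supp k t h; ⟨by linarith [h'.1, hδa k, hδpos k, hab], by linarith [h'.2, hδb k, hδpos k]⟩)
      rw [h1, h2]; ring
  -- ### the `α y` and `β₀` terms: dominated convergence
  have hA : Tendsto (fun k => ∫ t, η k t * (α t * (∫ x, ‖u t x - heatFlow u₀ (ν * t) x‖ ^ 2 * cutoff R x))) atTop (𝓝 (∫ t in Icc a b, α t * (∫ x, ‖u t x - heatFlow u₀ (ν * t) x‖ ^ 2 * cutoff R x))) := by
    have e1 : ∀ k, (∫ t, η k t * (α t * (∫ x, ‖u t x - heatFlow u₀ (ν * t) x‖ ^ 2 * cutoff R x))) = ∫ t, η k t * indicator (Icc a' b') (fun t => α t * y t) t := by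
      intro k
      refine integral_congr_ae (ae_of_all _ fun t => ?_)
      show η k t * (α t * (∫ x, ‖u t x - heatFlow u₀ (ν * t) x‖ ^ 2 * cutoff R x)) = η k t * indicator (Icc a' b') (fun t => α t * y t) t
      by_cases ht : t ∈ Icc a' b'
      · rw [indicator_of_mem ht]
      · rw [hηout' k t ht, zero_mul, zero_mul]
    simp_rw [e1]
    rw [← integral_indicator measurableSet_Icc]
    refine tendsto_integral_of_dominated_convergence (fun t => ‖indicator (Icc a' b') (fun t => α t * y t) t‖)
      (fun k => (hηm k).mul hαyI.aestronglyMeasurable) hαyI.norm (fun k => ae_of_all _ fun t => ?_)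
      (ae_of_all _ fun t => ?_)
    · rw [norm_mul, Real.norm_eq_abs, abs_of_nonneg (hη0 k t)]
      exact mul_le_of_le_one_left (norm_nonneg _) (hη1 k t)
    · by_cases ht : t ∈ Icc a b
      · have hmem : t ∈ Icc a' b' := ⟨ha'a.le.trans ht.1, ht.2.trans hbb'.le⟩
        have : ∀ k, η k t * indicator (Icc a' b') (fun t => α t * y t) t = indicator (Icc a b) (fun t => α t * (∫ x, ‖u t x - heatFlow u₀ (ν * t) x‖ ^ 2 * cutoff R x)) t := by
          intro k; rw [hηone k t ht, one_mul, indicator_of_mem hmem, indicator_of_mem ht]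
        simp_rw [this]
        exact tendsto_const_nhds
      · rw [indicator_of_notMem ht]
        have hev : ∀ᶠ k in atTop, η k t = 0 := by
          rw [mem_Icc, not_and_or, not_le, not_le] at ht
          rcases ht with h | h
          · filter_upwards [hδlim.eventually (gt_mem_nhds (sub_pos.2 h))] with k hk
            exact hηout k t fun hm => by linarith [hm.1]
          · filter_upwards [hδlim.eventually (gt_mem_nhds (sub_pos.2 h))] with k hk
            exact hηout k t fun hm => by linarith [hm.2]
        refine tendsto_const_nhds.congr' (hev.mono fun k hk => ?_)
        show (0 : ℝ) = η k t * _
        rw [hk, zero_mul]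
  have hBβ : Tendsto (fun k => ∫ t, η k t * (M * (∫ x, ‖u₀ x‖ ^ 3) / ν)) atTop (𝓝 (∫ t in Icc a b, (M * (∫ x, ‖u₀ x‖ ^ 3) / ν))) := by
    have hci : Integrable (indicator (Icc a' b') fun _ : ℝ => (M * (∫ x, ‖u₀ x‖ ^ 3) / ν)) :=
      (integrable_indicator_iff measurableSet_Icc).2 (integrableOn_const (hs := measure_Icc_lt_top.ne))
    have e1 : ∀ k, (∫ t, η k t * (M * (∫ x, ‖u₀ x‖ ^ 3) / ν)) = ∫ t, η k t * indicator (Icc a' b') (fun _ : ℝ => (M * (∫ x, ‖u₀ x‖ ^ 3) / ν)) t := by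
      intro k
      refine integral_congr_ae (ae_of_all _ fun t => ?_)
      show η k t * (M * (∫ x, ‖u₀ x‖ ^ 3) / ν) = η k t * indicator (Icc a' b') (fun _ : ℝ => (M * (∫ x, ‖u₀ x‖ ^ 3) / ν)) t
      by_cases ht : t ∈ Icc a' b'
      · rw [indicator_of_mem ht]
      · rw [hηout' k t ht, zero_mul, zero_mul]
    simp_rw [e1]
    rw [← integral_indicator measurableSet_Icc]
    refine tendsto_integral_of_dominated_convergence (fun t => ‖indicator (Icc a' b') (fun _ : ℝ => (M * (∫ x, ‖u₀ x‖ ^ 3) / ν)) t‖)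
      (fun k => (hηm k).mul hci.aestronglyMeasurable) hci.norm (fun k => ae_of_all _ fun t => ?_)
      (ae_of_all _ fun t => ?_)
    · rw [norm_mul, Real.norm_eq_abs, abs_of_nonneg (hη0 k t)]
      exact mul_le_of_le_one_left (norm_nonneg _) (hη1 k t)
    · by_cases ht : t ∈ Icc a b
      · have hmem : t ∈ Icc a' b' := ⟨ha'a.le.trans ht.1, ht.2.trans hbb'.le⟩
        have : ∀ k, η k t * indicator (Icc a' b') (fun _ : ℝ => (M * (∫ x, ‖u₀ x‖ ^ 3) / ν)) t = indicator (Icc a b) (fun _ : ℝ => (M * (∫ x, ‖u₀ x‖ ^ 3) / ν)) t := by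
          intro k; rw [hηone k t ht, one_mul, indicator_of_mem hmem, indicator_of_mem ht]
        simp_rw [this]
        exact tendsto_const_nhds
      · rw [indicator_of_notMem ht]
        have hev : ∀ᶠ k in atTop, η k t = 0 := by
          rw [mem_Icc, not_and_or, not_le, not_le] at ht
          rcases ht with h | h
          · filter_upwards [hδlim.eventually (gt_mem_nhds (sub_pos.2 h))] with k hk
            exact hηout k t fun hm => by linarith [hm.1]
          · filter_upwards [hδlim.eventually (gt_mem_nhds (sub_pos.2 h))] with k hk
            exact hηout k t fun hm => by linarith [hm.2]
        refine tendsto_const_nhds.congr' (hev.mono fun k hk => ?_)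
        show (0 : ℝ) = η k t * _
        rw [hk, zero_mul]
  -- ### the left-hand side: `ν ∫_{[a,b]} g ≤ ν ∫ η_k g`
  have hLk : ∀ k, ν * ∫ t in Icc a b, (∫ x, frobeniusNormSq (G t x - fderiv ℝ (heatFlow u₀ (ν * t)) x) * cutoff R x) ≤ ν * ∫ t, η k t * (∫ x, frobeniusNormSq (G t x - fderiv ℝ (heatFlow u₀ (ν * t)) x) * cutoff R x) := by
    intro k
    refine mul_le_mul_of_nonneg_left ?_ hν.le
    rw [← integral_indicator measurableSet_Icc]
    have hi1 : Integrable (indicator (Icc a b) g) := by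
      have : indicator (Icc a b) g = indicator (Icc a b) (indicator (Icc a' b') g) := by
        rw [indicator_indicator, inter_eq_self_of_subset_left
          (Icc_subset_Icc ha'a.le hbb'.le)]
      rw [this]
      exact hgI.indicator measurableSet_Icc
    have hi2 : Integrable (fun t => η k t * (∫ x, frobeniusNormSq (G t x - fderiv ℝ (heatFlow u₀ (ν * t)) x) * cutoff R x)) := by
      refine (hgI.bdd_mul (c := 1) (hηm k) (ae_of_all _ fun t => by
        rw [Real.norm_eq_abs, abs_of_nonneg (hη0 k t)]; exact hη1 k t)).congr (ae_of_all _ fun t => ?_)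
      · show η k t * indicator (Icc a' b') g t = η k t * (∫ x, frobeniusNormSq (G t x - fderiv ℝ (heatFlow u₀ (ν * t)) x) * cutoff R x)
        by_cases ht : t ∈ Icc a' b'
        · rw [indicator_of_mem ht]
        · rw [hηout' k t ht, zero_mul, zero_mul]
    refine integral_mono hi1 hi2 fun t => ?_
    show indicator (Icc a b) g t ≤ η k t * (∫ x, frobeniusNormSq (G t x - fderiv ℝ (heatFlow u₀ (ν * t)) x) * cutoff R x)
    by_cases ht : t ∈ Icc a b
    · rw [indicator_of_mem ht, hηone k t ht, one_mul]
    · rw [indicator_of_notMem ht]; exact mul_nonneg (hη0 k t) (hg0 t)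
  -- ### passage to the limit `k → ∞`
  have hk : ∀ k, ν * ∫ t in Icc a b, (∫ x, frobeniusNormSq (G t x - fderiv ℝ (heatFlow u₀ (ν * t)) x) * cutoff R x) ≤
      ((∫ t, κ₁ k t * Y t) - ∫ t, κ₂ k t * Y t) + (∫ t, η k t * (α t * (∫ x, ‖u t x - heatFlow u₀ (ν * t) x‖ ^ 2 * cutoff R x))) + (∫ t, η k t * (M * (∫ x, ‖u₀ x‖ ^ 3) / ν)) + Err / R := by
    intro k
    have h := hB (a - δ k) (b + δ k) (by linarith [hδa k]) (by linarith [hδpos k, hab]) (by linarith [hδb k])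
      (η k) (hηC k) (hη0 k) (hη1 k) (hηsupp k) R hR
    rw [hE k] at h
    exact (hLk k).trans h
  have hlim : Tendsto (fun k => ((∫ t, κ₁ k t * Y t) - ∫ t, κ₂ k t * Y t) + (∫ t, η k t * (α t * (∫ x, ‖u t x - heatFlow u₀ (ν * t) x‖ ^ 2 * cutoff R x))) +
      (∫ t, η k t * (M * (∫ x, ‖u₀ x‖ ^ 3) / ν)) + Err / R) atTop
      (𝓝 ((Y a - Y b) + (∫ t in Icc a b, α t * (∫ x, ‖u t x - heatFlow u₀ (ν * t) x‖ ^ 2 * cutoff R x)) + (∫ t in Icc a b, (M * (∫ x, ‖u₀ x‖ ^ 3) / ν)) + Err / R)) :=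
    (((hE1.sub hE2).add hA).add hBβ).add tendsto_const_nhds
  have hfin := le_of_tendsto_of_tendsto' tendsto_const_nhds hlim hk
  rw [hYa', hYb'] at hfin
  have hsum : (∫ t in Icc a b, (α t * (∫ x, ‖u t x - heatFlow u₀ (ν * t) x‖ ^ 2 * cutoff R x) + (M * (∫ x, ‖u₀ x‖ ^ 3) / ν))) = (∫ t in Icc a b, α t * (∫ x, ‖u t x - heatFlow u₀ (ν * t) x‖ ^ 2 * cutoff R x)) + ∫ t in Icc a b, (M * (∫ x, ‖u₀ x‖ ^ 3) / ν) := by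
    refine integral_add ?_ (integrableOn_const (hs := measure_Icc_lt_top.ne))
    exact (hαyc.mono (Icc_subset_Icc ha'a.le hbb'.le)).integrableOn_compact isCompact_Icc
  rw [hsum]
  linarith

end Window

end Literature.Analysis.FluidPDE

end
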